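import Mathlib
import HarnessLib
import Summits.Ventures.LatticeQCDFlow.Exactness.SUNJitteredHMCCertificates
import Summits.Ventures.LatticeQCDFlow.Exactness.NCMCGeneralSpaceDoeblinPowerCLT
import Summits.Ventures.LatticeQCDFlow.Scoring.DoeblinPowerBatchMeansCLT
import Summits.Ventures.LatticeQCDFlow.Scoring.DoeblinPowerBatchMeansTauInt

/-!
# The error bars of a run of the engine's jittered `SU(N)` HMC: CLT for time averages, consistent batch-means `σ̂²`, asymptotically exact coverage, consistent `τ̂_int` — from EVERY start, for EVERY production trajectory length, whenever one atom of the jitter law is short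

HONEST FRAMING: exact (Metropolis-corrected) sampling algorithms for lattice gauge theory;
figures of merit are autocorrelation/cost numbers at stated couplings and volumes; no
continuum-physics claim.

Venture `LatticeQCDFlow` (cell pub-lqcd), topic `Exactness`, FANOUT row 9 (eng-latcore, GEN-23; the engine
`latflow.core.hmc.HMC(f, β, 'leapfrog').trajectory(τ, nstep, tau_jitter = j)`, reported with batch-means /
Γ-method error bars by the HMC arms).  NEW WORK of the cell over the tree, nothing cited as a fact, no number
claimed: GEN-23's `SUNJitteredHMCCertificates.lean` (`wilsonJitterHMC`, `wilsonJitterHMC_invariant`,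
`wilsonJitterHMC_certificate`), row 13's `NCMCGeneralSpaceDoeblinPowerCLT.lean`
(`tendstoInDistribution_timeAverage_of_nHit`), row 8's `Scoring/DoeblinPowerBatchMeans*.lean`
(`chain_batchMeans_sigmaHat_tendstoInMeasure_of_nHit`, `doeblinPower_batchMeans_studentized_coverage`,
`chain_batchMeans_tauInt_tendstoInMeasure_of_nHit`).  It is the `tau_jitter` twin of row 21's
`Scoring/SUNMultiStepLeapfrogHMCBatchMeans.lean` (fixed short trajectories; "OMF words / `tau_jitter`" listed there
as NOT CLAIMED): with `tau_jitter` the short-trajectory restriction moves from the production length `τ` to "ONE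
atom of the jitter law is short", so the statements below hold for EVERY production length.  Printed counterparts
NAMED ONLY: Kipnis–Varadhan 1986 / Meyn–Tweedie 1993 ch. 17 (Markov-chain CLT); Flegal–Jones 2010 (batch means);
Madras–Sokal 1988 / Wolff 2004 (`τ_int`).

## Content (torus `(ℤ/L)^d`, `G = SU(N)`, `N, L ≥ 1`, any real `β`, `π = wilsonMeasure (β/N)`; every theorem:
## `∃ τ₀ > 0` on `N, d, L, β` only, then for EVERY `nstep`, `τ`, `η`, atom `l₀` with `η{l₀} ≠ 0`, `nstep l₀ ≥ 1`,
## `0 < τ l₀ ≤ τ₀`, EVERY bounded measurable `f`, EVERY initial law `μ₀`; `σ²_f` = the Green–Kubo variance)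

* **`wilsonJitterHMC_timeAverage_clt`** — `(√n)⁻¹ Σ_{t<n} (f(U_t) − π f) ⇒ N(0, σ²_f)` under `P_{μ₀}`.
* **`wilsonJitterHMC_batchMeans_tendstoInMeasure`** — `a b · SE²_BM → σ²_f` in probability (`a, b → ∞`).
* **`wilsonJitterHMC_batchMeans_coverage`** — `σ²_f > 0`, `z > 0`:
  `P_{μ₀}(|√(ab) (f̄ − π f)| ≤ z σ̂_BM) → N(0,1)([−z, z])` — the batch-means interval is asymptotically exact.
* **`wilsonJitterHMC_tauInt_tendstoInMeasure`** — `Var_π f ≠ 0`: the reported `τ̂_int = σ̂²_BM/(2 v̂)` converges in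
  probability to `τ_int(ρ_f) = 1/2 + Σ_{t≥1} ρ_f(t)` (scorers' `Scoring.tauInt`).
* **`wilsonJitterHMC_exactStep_timeAverage_clt`**, **`wilsonJitterHMC_exactStep_batchMeans_coverage`** — the same
  CLT and coverage for `P ∘ K_jit` with ANY Markov `P` leaving `π` invariant: the engine's
  `'hmc' (jittered) + n_or × 'or'` composite as run, or any exact sweep in between.

NOT CLAIMED: any rate; `σ²_f > 0` / `Var f ≠ 0` (assumed where stated); unbounded observables (the topological
charge after flow is bounded on the compact configuration space, but its flow is not typed here); atomless jitter
laws; every atom long; OMF words; floating point.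
-/

noncomputable section

namespace Summit.Ventures.LatticeQCDFlow.Exactness

open MeasureTheory ProbabilityTheory ProbabilityTheory.Kernel Set Function Filter Topology
open Literature.MathematicalPhysics.QuantumFieldTheory
open Literature.MathematicalPhysics.QuantumLattice (fundamentalRep continuous_fundamentalRep)
open Summit.Ventures.LatticeQCDFlow.Scoring (replicaSEsq tauInt autocov kop)
open scoped ENNReal Matrix Matrix.Norms.Operator NNReal

set_option backward.isDefEq.respectTransparency false

section ErrorBars

variable {N d L : ℕ} [NeZero N] [NeZero L] (β : ℝ)
variable {Lab : Type*} [Countable Lab] [MeasurableSpace Lab] [MeasurableSingletonClass Lab]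

/-- **THE CLT FOR TIME AVERAGES OF THE ENGINE'S JITTERED `SU(N)` HMC AS RUN, FROM EVERY INITIAL LAW, FOR EVERY
PRODUCTION LENGTH**: one short atom of the jitter law suffices; for `|f| ≤ C` measurable and `Y ~ N(0, σ²_f)`:
`(√n)⁻¹ Σ_{t<n} (f(U_t) − π f) ⇒ Y` under `P_{μ₀}` (the path law is a probability law — the bracketed instance
is Mathlib's, spelled out as in row 13's `tendstoInDistribution_timeAverage_of_nHit`). -/
theorem wilsonJitterHMC_timeAverage_clt :
    ∃ τ₀ : ℝ, 0 < τ₀ ∧ ∀ (nstep : Lab → ℕ) (τ : Lab → ℝ) (η : Measure Lab) [IsProbabilityMeasure η] (l₀ : Lab),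
      1 ≤ nstep l₀ → η {l₀} ≠ 0 → 0 < τ l₀ → τ l₀ ≤ τ₀ →
      ∀ (f : GaugeConfig d L (Matrix.specialUnitaryGroup (Fin N) ℂ) → ℝ), Measurable f → ∀ C : ℝ, (∀ U, |f U| ≤ C) →
      ∀ (μ₀ : Measure (GaugeConfig d L (Matrix.specialUnitaryGroup (Fin N) ℂ))) [IsProbabilityMeasure μ₀]
        [IsProbabilityMeasure (Kernel.trajMeasure (X := fun _ : ℕ => GaugeConfig d L (Matrix.specialUnitaryGroup (Fin N) ℂ)) μ₀
          (fun t : ℕ => (wilsonJitterHMC N d L β nstep τ η).comap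
            (fun h : (i : ↥(Finset.Iic t)) → GaugeConfig d L (Matrix.specialUnitaryGroup (Fin N) ℂ) =>
              h ⟨t, Finset.mem_Iic.2 le_rfl⟩) (measurable_pi_apply _)))]
        {Ω' : Type} [MeasurableSpace Ω'] (P' : Measure Ω') [IsProbabilityMeasure P'] (Y : Ω' → ℝ),
        HasLaw Y (gaussianReal 0 (Real.toNNReal
          ((∫ y, (f y - ∫ z, f z ∂(wilsonMeasure (d := d) (L := L) (fundamentalRep (Fin N)) (β / N))) ^ 2 ∂(wilsonMeasure (d := d) (L := L) (fundamentalRep (Fin N)) (β / N)))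
              + 2 * ∑' k, ∫ y, (f y - ∫ z, f z ∂(wilsonMeasure (d := d) (L := L) (fundamentalRep (Fin N)) (β / N)))
                * (Scoring.kop (wilsonJitterHMC N d L β nstep τ η))^[k + 1]
                  (fun y => f y - ∫ z, f z ∂(wilsonMeasure (d := d) (L := L) (fundamentalRep (Fin N)) (β / N))) y ∂(wilsonMeasure (d := d) (L := L) (fundamentalRep (Fin N)) (β / N))))) P' →
        TendstoInDistribution (fun (n : ℕ) (x : ℕ → GaugeConfig d L (Matrix.specialUnitaryGroup (Fin N) ℂ)) =>
            (Real.sqrt n)⁻¹ * ∑ t ∈ Finset.range n, (f (x t) - ∫ z, f z ∂(wilsonMeasure (d := d) (L := L) (fundamentalRep (Fin N)) (β / N))))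
          atTop Y (fun _ => (Kernel.trajMeasure (X := fun _ : ℕ => GaugeConfig d L (Matrix.specialUnitaryGroup (Fin N) ℂ)) μ₀
              (fun t : ℕ => (wilsonJitterHMC N d L β nstep τ η).comap
                (fun h : (i : ↥(Finset.Iic t)) → GaugeConfig d L (Matrix.specialUnitaryGroup (Fin N) ℂ) =>
                  h ⟨t, Finset.mem_Iic.2 le_rfl⟩) (measurable_pi_apply _)))) P' := by
  obtain ⟨τ₀, hτ₀, h⟩ := wilsonJitterHMC_certificate (N := N) (d := d) (L := L) (Lab := Lab) β
  refine ⟨τ₀, hτ₀, fun nstep τ η _ l₀ hn hl₀ hτl hτl₀ f hf C hC μ₀ _ _ Ω' _ P' _ Y hY => ?_⟩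
  obtain ⟨m, ε', hm, hε0, -, hmin⟩ := h nstep τ η l₀ hn hl₀ hτl hτl₀
  exact GeneralNCMC.tendstoInDistribution_timeAverage_of_nHit
    (wilsonJitterHMC_invariant (N := N) (d := d) (L := L) β nstep τ η) hε0.ne' hmin hm hf hC μ₀ hY

/-- **BATCH MEANS ESTIMATE `σ²_f` CONSISTENTLY ALONG THE ENGINE'S JITTERED `SU(N)` HMC, FROM EVERY INITIAL LAW**:
`a b · SE²_BM → σ²_f` in probability as the number of batches `a` and the batch length `b` go to infinity. -/
theorem wilsonJitterHMC_batchMeans_tendstoInMeasure :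
    ∃ τ₀ : ℝ, 0 < τ₀ ∧ ∀ (nstep : Lab → ℕ) (τ : Lab → ℝ) (η : Measure Lab) [IsProbabilityMeasure η] (l₀ : Lab),
      1 ≤ nstep l₀ → η {l₀} ≠ 0 → 0 < τ l₀ → τ l₀ ≤ τ₀ →
      ∀ (f : GaugeConfig d L (Matrix.specialUnitaryGroup (Fin N) ℂ) → ℝ), Measurable f → ∀ C : ℝ, (∀ U, |f U| ≤ C) →
      ∀ (μ₀ : Measure (GaugeConfig d L (Matrix.specialUnitaryGroup (Fin N) ℂ))) [IsProbabilityMeasure μ₀] (a b' : ℕ → ℕ),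
        Tendsto a atTop atTop → Tendsto b' atTop atTop →
        TendstoInMeasure (Kernel.trajMeasure (X := fun _ : ℕ => GaugeConfig d L (Matrix.specialUnitaryGroup (Fin N) ℂ)) μ₀
              (fun t : ℕ => (wilsonJitterHMC N d L β nstep τ η).comap
                (fun h : (i : ↥(Finset.Iic t)) → GaugeConfig d L (Matrix.specialUnitaryGroup (Fin N) ℂ) =>
                  h ⟨t, Finset.mem_Iic.2 le_rfl⟩) (measurable_pi_apply _)))
          (fun (n : ℕ) (x : ℕ → GaugeConfig d L (Matrix.specialUnitaryGroup (Fin N) ℂ)) => ((b' n * a n : ℕ) : ℝ)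
            * replicaSEsq (fun j (x : ℕ → GaugeConfig d L (Matrix.specialUnitaryGroup (Fin N) ℂ)) =>
                (∑ i ∈ Finset.range (b' n), f (x (b' n * j + i))) / (b' n)) (a n) x)
          atTop (fun _ => (∫ y, (f y - ∫ z, f z ∂(wilsonMeasure (d := d) (L := L) (fundamentalRep (Fin N)) (β / N))) ^ 2 ∂(wilsonMeasure (d := d) (L := L) (fundamentalRep (Fin N)) (β / N)))
              + 2 * ∑' k, ∫ y, (f y - ∫ z, f z ∂(wilsonMeasure (d := d) (L := L) (fundamentalRep (Fin N)) (β / N)))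
                * (Scoring.kop (wilsonJitterHMC N d L β nstep τ η))^[k + 1]
                  (fun y => f y - ∫ z, f z ∂(wilsonMeasure (d := d) (L := L) (fundamentalRep (Fin N)) (β / N))) y ∂(wilsonMeasure (d := d) (L := L) (fundamentalRep (Fin N)) (β / N))) := by
  obtain ⟨τ₀, hτ₀, h⟩ := wilsonJitterHMC_certificate (N := N) (d := d) (L := L) (Lab := Lab) β
  refine ⟨τ₀, hτ₀, fun nstep τ η _ l₀ hn hl₀ hτl hτl₀ f hf C hC μ₀ _ a b' ha hb' => ?_⟩
  obtain ⟨m, ε', hm, hε0, hε1, hmin⟩ := h nstep τ η l₀ hn hl₀ hτl hτl₀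
  exact Scoring.chain_batchMeans_sigmaHat_tendstoInMeasure_of_nHit
    (wilsonJitterHMC_invariant (N := N) (d := d) (L := L) β nstep τ η)
    (GeneralNCMC.minorised_setwise hmin) hε0 hε1 hm hf hC μ₀ ha hb'

/-- **THE BATCH-MEANS INTERVAL OF A JITTERED-HMC RUN IS ASYMPTOTICALLY EXACT** (`σ²_f > 0`, `a, b → ∞`, any
initial law, `z > 0`): `P_{μ₀}(|√(ab) (f̄_{ab} − π f)| ≤ z σ̂_BM) → (gaussianReal 0 1)[−z, z]`. -/
theorem wilsonJitterHMC_batchMeans_coverage :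
    ∃ τ₀ : ℝ, 0 < τ₀ ∧ ∀ (nstep : Lab → ℕ) (τ : Lab → ℝ) (η : Measure Lab) [IsProbabilityMeasure η] (l₀ : Lab),
      1 ≤ nstep l₀ → η {l₀} ≠ 0 → 0 < τ l₀ → τ l₀ ≤ τ₀ →
      ∀ (f : GaugeConfig d L (Matrix.specialUnitaryGroup (Fin N) ℂ) → ℝ), Measurable f → ∀ C : ℝ, (∀ U, |f U| ≤ C) →
        0 < (∫ y, (f y - ∫ z, f z ∂(wilsonMeasure (d := d) (L := L) (fundamentalRep (Fin N)) (β / N))) ^ 2 ∂(wilsonMeasure (d := d) (L := L) (fundamentalRep (Fin N)) (β / N)))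
              + 2 * ∑' k, ∫ y, (f y - ∫ z, f z ∂(wilsonMeasure (d := d) (L := L) (fundamentalRep (Fin N)) (β / N)))
                * (Scoring.kop (wilsonJitterHMC N d L β nstep τ η))^[k + 1]
                  (fun y => f y - ∫ z, f z ∂(wilsonMeasure (d := d) (L := L) (fundamentalRep (Fin N)) (β / N))) y ∂(wilsonMeasure (d := d) (L := L) (fundamentalRep (Fin N)) (β / N)) →
      ∀ (μ₀ : Measure (GaugeConfig d L (Matrix.specialUnitaryGroup (Fin N) ℂ))) [IsProbabilityMeasure μ₀] (a b' : ℕ → ℕ),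
        Tendsto a atTop atTop → Tendsto b' atTop atTop → ∀ z : ℝ, 0 < z →
        Tendsto (fun n : ℕ => (Kernel.trajMeasure (X := fun _ : ℕ => GaugeConfig d L (Matrix.specialUnitaryGroup (Fin N) ℂ)) μ₀
              (fun t : ℕ => (wilsonJitterHMC N d L β nstep τ η).comap
                (fun h : (i : ↥(Finset.Iic t)) → GaugeConfig d L (Matrix.specialUnitaryGroup (Fin N) ℂ) =>
                  h ⟨t, Finset.mem_Iic.2 le_rfl⟩) (measurable_pi_apply _))).real
          {x | |((Real.sqrt ((b' n * a n : ℕ) : ℝ))⁻¹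
              * ∑ t ∈ Finset.range (b' n * a n), (f (x t) - ∫ z, f z ∂(wilsonMeasure (d := d) (L := L) (fundamentalRep (Fin N)) (β / N))))
            / Real.sqrt (((b' n * a n : ℕ) : ℝ)
              * replicaSEsq (fun j (x : ℕ → GaugeConfig d L (Matrix.specialUnitaryGroup (Fin N) ℂ)) =>
                  (∑ i ∈ Finset.range (b' n), f (x (b' n * j + i))) / (b' n)) (a n) x)| ≤ z})
          atTop (𝓝 ((gaussianReal 0 1).real (Set.Icc (-z) z))) := by
  obtain ⟨τ₀, hτ₀, h⟩ := wilsonJitterHMC_certificate (N := N) (d := d) (L := L) (Lab := Lab) β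
  refine ⟨τ₀, hτ₀, fun nstep τ η _ l₀ hn hl₀ hτl hτl₀ f hf C hC hσ μ₀ _ a b' ha hb' z hz => ?_⟩
  obtain ⟨m, ε', hm, hε0, hε1, hmin⟩ := h nstep τ η l₀ hn hl₀ hτl hτl₀
  exact Scoring.doeblinPower_batchMeans_studentized_coverage
    (wilsonJitterHMC_invariant (N := N) (d := d) (L := L) β nstep τ η) hmin hε0 hε1 hm hf hC hσ μ₀ ha hb' hz

/-- **THE REPORTED `τ̂_int = σ̂²_BM/(2 v̂)` OF A JITTERED-HMC RUN IS CONSISTENT** (`Var_π f ≠ 0`, `a, b → ∞`, any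
initial law): `σ̂²/(2 v̂) → τ_int(ρ_f)` in probability, `ρ_f(t) = C_f(t)/C_f(0)` the normalised autocorrelation
function of `f` in equilibrium and `τ_int` the scorers' `1/2 + Σ_{t≥1} ρ_f(t)`. -/
theorem wilsonJitterHMC_tauInt_tendstoInMeasure :
    ∃ τ₀ : ℝ, 0 < τ₀ ∧ ∀ (nstep : Lab → ℕ) (τ : Lab → ℝ) (η : Measure Lab) [IsProbabilityMeasure η] (l₀ : Lab),
      1 ≤ nstep l₀ → η {l₀} ≠ 0 → 0 < τ l₀ → τ l₀ ≤ τ₀ →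
      ∀ (f : GaugeConfig d L (Matrix.specialUnitaryGroup (Fin N) ℂ) → ℝ), Measurable f → ∀ C : ℝ, (∀ U, |f U| ≤ C) →
        autocov (wilsonJitterHMC N d L β nstep τ η) (wilsonMeasure (d := d) (L := L) (fundamentalRep (Fin N)) (β / N))
          (fun y => f y - ∫ z, f z ∂(wilsonMeasure (d := d) (L := L) (fundamentalRep (Fin N)) (β / N))) 0 ≠ 0 →
      ∀ (μ₀ : Measure (GaugeConfig d L (Matrix.specialUnitaryGroup (Fin N) ℂ))) [IsProbabilityMeasure μ₀] (a b' : ℕ → ℕ),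
        Tendsto a atTop atTop → Tendsto b' atTop atTop →
        TendstoInMeasure (Kernel.trajMeasure (X := fun _ : ℕ => GaugeConfig d L (Matrix.specialUnitaryGroup (Fin N) ℂ)) μ₀
              (fun t : ℕ => (wilsonJitterHMC N d L β nstep τ η).comap
                (fun h : (i : ↥(Finset.Iic t)) → GaugeConfig d L (Matrix.specialUnitaryGroup (Fin N) ℂ) =>
                  h ⟨t, Finset.mem_Iic.2 le_rfl⟩) (measurable_pi_apply _)))
          (fun (n : ℕ) (x : ℕ → GaugeConfig d L (Matrix.specialUnitaryGroup (Fin N) ℂ)) =>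
            (((b' n * a n : ℕ) : ℝ)
              * replicaSEsq (fun j (x : ℕ → GaugeConfig d L (Matrix.specialUnitaryGroup (Fin N) ℂ)) =>
                  (∑ i ∈ Finset.range (b' n), f (x (b' n * j + i))) / (b' n)) (a n) x)
            / (2 * ((∑ t ∈ Finset.range (b' n * a n), f (x t) ^ 2) / ((b' n * a n : ℕ) : ℝ)
                - ((∑ t ∈ Finset.range (b' n * a n), f (x t)) / ((b' n * a n : ℕ) : ℝ)) ^ 2)))
          atTop (fun _ => tauInt (fun t =>
            autocov (wilsonJitterHMC N d L β nstep τ η) (wilsonMeasure (d := d) (L := L) (fundamentalRep (Fin N)) (β / N))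
                (fun y => f y - ∫ z, f z ∂(wilsonMeasure (d := d) (L := L) (fundamentalRep (Fin N)) (β / N))) t
              / autocov (wilsonJitterHMC N d L β nstep τ η) (wilsonMeasure (d := d) (L := L) (fundamentalRep (Fin N)) (β / N))
                (fun y => f y - ∫ z, f z ∂(wilsonMeasure (d := d) (L := L) (fundamentalRep (Fin N)) (β / N))) 0)) := by
  obtain ⟨τ₀, hτ₀, h⟩ := wilsonJitterHMC_certificate (N := N) (d := d) (L := L) (Lab := Lab) β
  refine ⟨τ₀, hτ₀, fun nstep τ η _ l₀ hn hl₀ hτl hτl₀ f hf C hC hvar μ₀ _ a b' ha hb' => ?_⟩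
  obtain ⟨m, ε', hm, hε0, hε1, hmin⟩ := h nstep τ η l₀ hn hl₀ hτl hτl₀
  exact Scoring.chain_batchMeans_tauInt_tendstoInMeasure_of_nHit
    (wilsonJitterHMC_invariant (N := N) (d := d) (L := L) β nstep τ η) hmin hε0 hε1 hm hf hC hvar μ₀ ha hb'

/-! ## The jittered engine HMC followed by ANY exact step (e.g. the `'hmc' + n_or × 'or'` composite as run) -/

/-- **THE CLT FOR TIME AVERAGES OF THE COMPOSITE `P ∘ K_jit`, FROM EVERY INITIAL LAW** — `P` ANY Markov kernel
leaving `wilsonMeasure (β/N)` invariant (any schedule of Cabibbo–Marinari over-relaxation hits, heat-bath sweeps,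
…); `|f| ≤ C` measurable, `Y ~ N(0, σ²_f)` (the composite's Green–Kubo variance). -/
theorem wilsonJitterHMC_exactStep_timeAverage_clt :
    ∃ τ₀ : ℝ, 0 < τ₀ ∧ ∀ (nstep : Lab → ℕ) (τ : Lab → ℝ) (η : Measure Lab) [IsProbabilityMeasure η] (l₀ : Lab),
      1 ≤ nstep l₀ → η {l₀} ≠ 0 → 0 < τ l₀ → τ l₀ ≤ τ₀ →
      ∀ (P : Kernel (GaugeConfig d L (Matrix.specialUnitaryGroup (Fin N) ℂ)) (GaugeConfig d L (Matrix.specialUnitaryGroup (Fin N) ℂ)))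
        [IsMarkovKernel P], Invariant P (wilsonMeasure (d := d) (L := L) (fundamentalRep (Fin N)) (β / N)) →
      ∀ (f : GaugeConfig d L (Matrix.specialUnitaryGroup (Fin N) ℂ) → ℝ), Measurable f → ∀ C : ℝ, (∀ U, |f U| ≤ C) →
      ∀ (μ₀ : Measure (GaugeConfig d L (Matrix.specialUnitaryGroup (Fin N) ℂ))) [IsProbabilityMeasure μ₀]
        [IsProbabilityMeasure (Kernel.trajMeasure (X := fun _ : ℕ => GaugeConfig d L (Matrix.specialUnitaryGroup (Fin N) ℂ)) μ₀
          (fun t : ℕ => (P ∘ₖ wilsonJitterHMC N d L β nstep τ η).comap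
            (fun h : (i : ↥(Finset.Iic t)) → GaugeConfig d L (Matrix.specialUnitaryGroup (Fin N) ℂ) =>
              h ⟨t, Finset.mem_Iic.2 le_rfl⟩) (measurable_pi_apply _)))]
        {Ω' : Type} [MeasurableSpace Ω'] (P' : Measure Ω') [IsProbabilityMeasure P'] (Y : Ω' → ℝ),
        HasLaw Y (gaussianReal 0 (Real.toNNReal
          ((∫ y, (f y - ∫ z, f z ∂(wilsonMeasure (d := d) (L := L) (fundamentalRep (Fin N)) (β / N))) ^ 2 ∂(wilsonMeasure (d := d) (L := L) (fundamentalRep (Fin N)) (β / N)))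
              + 2 * ∑' k, ∫ y, (f y - ∫ z, f z ∂(wilsonMeasure (d := d) (L := L) (fundamentalRep (Fin N)) (β / N)))
                * (Scoring.kop (P ∘ₖ wilsonJitterHMC N d L β nstep τ η))^[k + 1]
                  (fun y => f y - ∫ z, f z ∂(wilsonMeasure (d := d) (L := L) (fundamentalRep (Fin N)) (β / N))) y ∂(wilsonMeasure (d := d) (L := L) (fundamentalRep (Fin N)) (β / N))))) P' →
        TendstoInDistribution (fun (n : ℕ) (x : ℕ → GaugeConfig d L (Matrix.specialUnitaryGroup (Fin N) ℂ)) =>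
            (Real.sqrt n)⁻¹ * ∑ t ∈ Finset.range n, (f (x t) - ∫ z, f z ∂(wilsonMeasure (d := d) (L := L) (fundamentalRep (Fin N)) (β / N))))
          atTop Y (fun _ => (Kernel.trajMeasure (X := fun _ : ℕ => GaugeConfig d L (Matrix.specialUnitaryGroup (Fin N) ℂ)) μ₀
              (fun t : ℕ => (P ∘ₖ wilsonJitterHMC N d L β nstep τ η).comap
                (fun h : (i : ↥(Finset.Iic t)) → GaugeConfig d L (Matrix.specialUnitaryGroup (Fin N) ℂ) =>
                  h ⟨t, Finset.mem_Iic.2 le_rfl⟩) (measurable_pi_apply _)))) P' := by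
  obtain ⟨τ₀, hτ₀, h⟩ := wilsonJitterHMC_exactStep_certificate (N := N) (d := d) (L := L) (Lab := Lab) β
  refine ⟨τ₀, hτ₀, fun nstep τ η _ l₀ hn hl₀ hτl hτl₀ P _ hP f hf C hC μ₀ _ _ Ω' _ P' _ Y hY => ?_⟩
  obtain ⟨hinv, m, ε', hm, hε0, -, hmin⟩ := h nstep τ η l₀ hn hl₀ hτl hτl₀ P hP
  exact GeneralNCMC.tendstoInDistribution_timeAverage_of_nHit hinv hε0.ne' hmin hm hf hC μ₀ hY

/-- **THE BATCH-MEANS INTERVAL OF A COMPOSITE `P ∘ K_jit` RUN IS ASYMPTOTICALLY EXACT** (`P` ANY Markov kernel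
leaving `wilsonMeasure (β/N)` invariant; `σ²_f > 0`, `a, b → ∞`, any initial law, `z > 0`):
`P_{μ₀}(|√(ab) (f̄_{ab} − π f)| ≤ z σ̂_BM) → (gaussianReal 0 1)[−z, z]`. -/
theorem wilsonJitterHMC_exactStep_batchMeans_coverage :
    ∃ τ₀ : ℝ, 0 < τ₀ ∧ ∀ (nstep : Lab → ℕ) (τ : Lab → ℝ) (η : Measure Lab) [IsProbabilityMeasure η] (l₀ : Lab),
      1 ≤ nstep l₀ → η {l₀} ≠ 0 → 0 < τ l₀ → τ l₀ ≤ τ₀ →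
      ∀ (P : Kernel (GaugeConfig d L (Matrix.specialUnitaryGroup (Fin N) ℂ)) (GaugeConfig d L (Matrix.specialUnitaryGroup (Fin N) ℂ)))
        [IsMarkovKernel P], Invariant P (wilsonMeasure (d := d) (L := L) (fundamentalRep (Fin N)) (β / N)) →
      ∀ (f : GaugeConfig d L (Matrix.specialUnitaryGroup (Fin N) ℂ) → ℝ), Measurable f → ∀ C : ℝ, (∀ U, |f U| ≤ C) →
        0 < (∫ y, (f y - ∫ z, f z ∂(wilsonMeasure (d := d) (L := L) (fundamentalRep (Fin N)) (β / N))) ^ 2 ∂(wilsonMeasure (d := d) (L := L) (fundamentalRep (Fin N)) (β / N)))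
              + 2 * ∑' k, ∫ y, (f y - ∫ z, f z ∂(wilsonMeasure (d := d) (L := L) (fundamentalRep (Fin N)) (β / N)))
                * (Scoring.kop (P ∘ₖ wilsonJitterHMC N d L β nstep τ η))^[k + 1]
                  (fun y => f y - ∫ z, f z ∂(wilsonMeasure (d := d) (L := L) (fundamentalRep (Fin N)) (β / N))) y ∂(wilsonMeasure (d := d) (L := L) (fundamentalRep (Fin N)) (β / N)) →
      ∀ (μ₀ : Measure (GaugeConfig d L (Matrix.specialUnitaryGroup (Fin N) ℂ))) [IsProbabilityMeasure μ₀] (a b' : ℕ → ℕ),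
        Tendsto a atTop atTop → Tendsto b' atTop atTop → ∀ z : ℝ, 0 < z →
        Tendsto (fun n : ℕ => (Kernel.trajMeasure (X := fun _ : ℕ => GaugeConfig d L (Matrix.specialUnitaryGroup (Fin N) ℂ)) μ₀
              (fun t : ℕ => (P ∘ₖ wilsonJitterHMC N d L β nstep τ η).comap
                (fun h : (i : ↥(Finset.Iic t)) → GaugeConfig d L (Matrix.specialUnitaryGroup (Fin N) ℂ) =>
                  h ⟨t, Finset.mem_Iic.2 le_rfl⟩) (measurable_pi_apply _))).real
          {x | |((Real.sqrt ((b' n * a n : ℕ) : ℝ))⁻¹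
              * ∑ t ∈ Finset.range (b' n * a n), (f (x t) - ∫ z, f z ∂(wilsonMeasure (d := d) (L := L) (fundamentalRep (Fin N)) (β / N))))
            / Real.sqrt (((b' n * a n : ℕ) : ℝ)
              * replicaSEsq (fun j (x : ℕ → GaugeConfig d L (Matrix.specialUnitaryGroup (Fin N) ℂ)) =>
                  (∑ i ∈ Finset.range (b' n), f (x (b' n * j + i))) / (b' n)) (a n) x)| ≤ z})
          atTop (𝓝 ((gaussianReal 0 1).real (Set.Icc (-z) z))) := by
  obtain ⟨τ₀, hτ₀, h⟩ := wilsonJitterHMC_exactStep_certificate (N := N) (d := d) (L := L) (Lab := Lab) β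
  refine ⟨τ₀, hτ₀, fun nstep τ η _ l₀ hn hl₀ hτl hτl₀ P _ hP f hf C hC hσ μ₀ _ a b' ha hb' z hz => ?_⟩
  obtain ⟨hinv, m, ε', hm, hε0, hε1, hmin⟩ := h nstep τ η l₀ hn hl₀ hτl hτl₀ P hP
  exact Scoring.doeblinPower_batchMeans_studentized_coverage hinv hmin hε0 hε1 hm hf hC hσ μ₀ ha hb' hz

end ErrorBars

end Summit.Ventures.LatticeQCDFlow.Exactness

end
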